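import Summits.QuantumFields.BalabanUV.T4Continuum.Spine.NE1p.DressedSmallFieldInnerLabelsWitness

/-!
# T⁴ programme, spine estimate NE1′ (node O3b/H2) — WITNESS «THE SECOND RESUMMATION STEP FIRES — THE UNCOVERED CUBE IS PAID BY A
# BOND», PART 2 (D1): the label-indexed toy of PART 1 is GENUINE — at the unit cube the activity is TWO live terms, the UNCOVERED
# label's among them, and the quantity bounded by N0u's END (PART 1's `innerEnd_fires`) is NOT zero

Cell `pub-balaban`, sub-cell `t4`, row NE1′ formalisation crew (`t4/formal/NE1p/LEAVES.md` row W50 ∕ DAG N29zzr; INTENT HOME/CLAIMS.log l.19461, BOOKED typer R-T125 (iii) l.19575; X163 its read),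
unit `b2b-balaban-t4-ne1p-formalise-leaf-06` (gen 11); PART 2 of 2 (D1).  ADDITIVE — imports PART 1
`Spine/NE1p/DressedSmallFieldInnerLabelsWitness` ONLY (→ leaf-07's `DressedSmallFieldInnerLink` → the owner's N0u; W45 → W41 → W35 → W33 →
W24); THEOREMS ONLY (0 def, 0 `def … : Prop`, 0 cite, 0 sorry, 0 `attribute`); nothing of PART 1 ∕ N0u ∕ InnerLink ∕ W45 ∕ W41 ∕ W35 ∕
W33 ∕ W24 is restated — `termsI`∕`cI`∕`GI`∕`actI`∕`sum_termsI_X₀`∕`cI_pos`∕`pI_pos`∕`pI_le_one`∕`sI_pos`∕`sI_le_one`∕`maj_le_one`∕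
`coveringFamilies_emptyFootprint`, `termAt_coreW_pencil`∕`closedForm_real_sub_zero`∕`norm_term_le`, `cM`, `crd`∕`incr`∕`integral_incr_pos`∕
`Acst`∕`Acst_pos`, `X₀`∕`X₀_val`∕`dressedConst_le_one`∕`exp_locE_cube` are used BY NAME.

WHAT IS GENUINE (R-T80 (vi)): `uncovered_mem_termsI` — the label `⟨{0}, (∅, {0})⟩` with an UNCOVERED cube and ONE bond IS a term of
`X₀`; `actI_X₀` — the activity at `X₀` in CLOSED FORM is the SUM OF TWO W33 closed forms (covered + uncovered label, PART 1's
`sum_termsI_X₀`, W41's `termAt_coreW_pencil`); `uncoveredTerm_live` — the uncovered label's OWN core term READS the table (its increment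
is `(cM r∕2)·sI²·∫ incr r ≠ 0`: the P-step's bond letter `(s²t)^{#P}` at `#P = 1`, `t = 1` is LIVE inside the END — at `t = 0` it would
vanish); `actI_live`; `norm_actI_X₀_lt_one` (both majorants `≤ 1`, W41's `norm_term_le`, W24's `A ≤ 1`); **`innerEnd_live`** — the
quantity PART 1's `innerEnd_fires` bounds is NOT zero (W24's `exp_locE_cube` BY NAME).

WORDING OF RECORD (crew row W50 = DAG N29zzr, typer R-T125 (iii): the holder's title of l.19461 + the typer's rider ADOPTED verbatim): «bonds READ AS
cubes (`Bnd := TPt 4 N`, `bondsOf W := W`, `b₀ := 1`), `foot = id`, «terms = all admissible inner labels» are OUR toy choices; the (2.27)∘(2.32) link is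
S40.1's theorem BY NAME, never restated; if S40.1 slips the witness WAITS».

HONEST FRAMING.  A DECIDED TOY ([folklore]; 0 sorry; 0 citations; 0 def).  The cores are row NE5's TOY frame instances of the cell's (2.14)
FORMAT — NOT Bałaban's terms; «bonds = cubes», `foot = id`, «terms = all admissible inner labels» are OUR toy choices (PART 1); (B1b) ∕
(B3) ∕ (B5) for Bałaban's (2.14) objects NOT discharged ((B3-amp) UNPRINTED, G-ne9p2-5); no numeral of [Balaban1988RGII] asserted; 0
binders instantiated on Bałaban's densities; no wall item; wall v1.7 (T4-DAG v44) does NOT move; R-t4r2-Q2 NOT met thereby; NE1′ ⇐ the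
named binders — NOT proved, NOT printed; spine PROVED 0∕9; count 9 unchanged.  Rung (B)+1 on ONE finite four-torus — NOT infinite volume,
NOT a mass gap, NOT OS on ℝ⁴, NOT Clay.  HONEST DEPENDENCY: continuum YM on T⁴ ⇐ BetaPertH ∧ nine spine estimates (0/9 proved); BetaPertH ⇐
(D1) ∧ (D4) ∧ CAP+tail; G-an2-4 gates asym, D1 and NE2/3/4.
-/

noncomputable section

namespace Summit.QuantumFields.BalabanUV.T4Continuum.NE1p.DressedSmallFieldInnerLabelsWitness

open Set Metric MeasureTheory Complex
open scoped BigOperators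
open Literature.MathematicalPhysics.QuantumFieldTheory.Balaban1983to89
open Literature.MathematicalPhysics.QuantumFieldTheory.Balaban1983to89.B13Resummation (locE)
open Literature.MathematicalPhysics.QuantumFieldTheory.Balaban1983to89.B13FamilySum (coveringFamilies mem_coveringFamilies)
open Literature.MathematicalPhysics.QuantumFieldTheory.Balaban1983to89.TreeLengthTorus (TPt TDom tsys)
open Literature.MathematicalPhysics.QuantumFieldTheory.Balaban1983to89.TreeLengthTorusGeometry (tgeometry TTouch)
open Summit.QuantumFields.BalabanUV.T4Continuum.B13HistMeasurable (B13HistM)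
open Summit.QuantumFields.BalabanUV.T4Continuum.B13HistWitness (toyFrame)
open Summit.QuantumFields.BalabanUV.T4Continuum.NE1p.DressedSmallFieldTorusWitness (X₀ X₀_val dressedConst_le_one exp_locE_cube)
open Summit.QuantumFields.BalabanUV.T4Continuum.NE1p.DressedSmallFieldCoresWitness (E1 crd liveTable Acst Acst_pos incr integral_incr_pos)
open Summit.QuantumFields.BalabanUV.T4Continuum.NE1p.DressedSmallFieldCoresMassWitness (cM cM_pos)
open Summit.QuantumFields.BalabanUV.T4Continuum.NE1p.DressedSmallFieldDepCoresWitness (termAt_coreW_pencil closedForm_real_sub_zero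
  norm_term_le)

section Torus
variable (N : ℕ) [NeZero N]

/-! ## §5a THE UNCOVERED LABEL IS A TERM -/

open Classical in
/-- The UNCOVERED label `⟨{0}, (∅, {0})⟩` IS a term of `X₀` (`W = {0} ≠ ∅`, `P = {0} ≠ ∅`; PART 1's `termsI`; the empty family covers `{0} ∖ {0} = ∅`). [folklore] -/
theorem uncovered_mem_termsI : (⟨{0}, (∅, {0})⟩ : Label N) ∈ termsI N (X₀ N) := by
  unfold termsI
  refine Finset.mem_sigma.2 ⟨by simp [X₀_val], Finset.mem_product.2 ⟨?_, Finset.mem_filter.2 ⟨by simp, by simp⟩⟩⟩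
  exact mem_coveringFamilies.2 ⟨Finset.empty_subset _, by simp [X₀_val]⟩

variable (r : ℝ) (hr : 0 ≤ r)

/-! ## §5b GENUINE: at `X₀` the activity is TWO live terms — the uncovered label's among them — and the END's quantity is NOT zero -/

/-- **THE ACTIVITY AT `X₀` IN CLOSED FORM — TWO TERMS**: the covered and the uncovered label, each W33's closed form at its weight
(`sum_termsI_X₀`, W41's `termAt_coreW_pencil` BY NAME): `actI k s X₀ = (cI cov + cI unc)·∫ e^{s·r·e^{−(v 0)²}}·e^{−‖v‖²} dv`. [folklore] -/
theorem actI_X₀ (k : ℕ) (s : ℂ) :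
    actI N r hr k s (X₀ N) =
      ((cI N r ⟨∅, ({X₀ N}, ∅)⟩ + cI N r ⟨{0}, (∅, {0})⟩ : ℝ) : ℂ) *
        ∫ v : E1, cexp (s * ((r : ℂ) * (Real.exp (-(crd v ^ 2)) : ℂ))) * cexp (-(((‖v‖ ^ 2 : ℝ) : ℂ))) := by
  unfold actI
  rw [sum_termsI_X₀, GI_apply, GI_apply, termAt_coreW_pencil, termAt_coreW_pencil, ← add_mul]
  push_cast
  ring

/-- The increment between a REAL source `t` and `0` at `X₀`: `(cI cov + cI unc)·∫ incr (t·r)` (W41's `closedForm_real_sub_zero`). [folklore] -/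
theorem actI_real_sub_zero (k : ℕ) (t : ℝ) :
    actI N r hr k (t : ℂ) (X₀ N) - actI N r hr k 0 (X₀ N) =
      ((cI N r ⟨∅, ({X₀ N}, ∅)⟩ + cI N r ⟨{0}, (∅, {0})⟩ : ℝ) : ℂ) * ((∫ v, incr (t * r) v : ℝ) : ℂ) := by
  rw [actI_X₀, actI_X₀]
  exact closedForm_real_sub_zero _ r hr t

/-- **THE UNCOVERED LABEL's OWN TERM READS THE TABLE** [decided toy]: its core's term at the source `1` differs from the one at `0` —
the increment is `(cM r∕2)·sI²·∫ incr r ≠ 0` (`cI_uncovered`, W33's `integral_incr_pos`): the P-step's bond letter is LIVE inside the END. [folklore] -/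
theorem uncoveredTerm_live (hr0 : 0 < r) (k : ℕ) :
    (GI N r hr k ⟨{0}, (∅, {0})⟩ k).termAt (0 : ℂ) ((0 : B13HistM toyFrame) + (1 : ℂ) • liveTable) ≠
      (GI N r hr k ⟨{0}, (∅, {0})⟩ k).termAt (0 : ℂ) ((0 : B13HistM toyFrame) + (0 : ℂ) • liveTable) := by
  intro h
  have h0 := sub_eq_zero.2 h
  rw [GI_apply, termAt_coreW_pencil, termAt_coreW_pencil, show (1 : ℂ) = ((1 : ℝ) : ℂ) from Complex.ofReal_one.symm,
    closedForm_real_sub_zero _ r hr 1, one_mul] at h0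
  rcases mul_eq_zero.1 h0 with hc | hI
  · exact (cI_pos N r ⟨{0}, (∅, {0})⟩).ne' (by exact_mod_cast hc)
  · exact (integral_incr_pos r hr0).ne' (by exact_mod_cast hI)

/-- **THE ATTACHED PART OF THE ACTIVITY IS NOT ZERO** (both weights positive, W33's `∫ incr r > 0` for `0 < r`). [folklore] -/
theorem actI_live (hr0 : 0 < r) (k : ℕ) : actI N r hr k 1 (X₀ N) ≠ actI N r hr k 0 (X₀ N) := by
  intro h
  have h0 := sub_eq_zero.2 h
  rw [show (1 : ℂ) = ((1 : ℝ) : ℂ) from Complex.ofReal_one.symm, actI_real_sub_zero, one_mul] at h0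
  rcases mul_eq_zero.1 h0 with hc | hI
  · have hpos : 0 < cI N r ⟨∅, ({X₀ N}, ∅)⟩ + cI N r ⟨{0}, (∅, {0})⟩ := add_pos (cI_pos N r _) (cI_pos N r _)
    exact hpos.ne' (by exact_mod_cast hc)
  · exact (integral_incr_pos r hr0).ne' (by exact_mod_cast hI)

/-- The activities at `X₀` lie STRICTLY inside the unit disc for `‖s‖ ≤ 2` (both majorants `≤ 1`, W41's `norm_term_le`, `A ≤ 1`,
`√π < √(2π)`). [folklore] -/
theorem norm_actI_X₀_lt_one (k : ℕ) {s : ℂ} (hs : ‖s‖ ≤ 2) : ‖actI N r hr k s (X₀ N)‖ < 1 := by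
  rw [actI_X₀]
  set m : ℝ := pI N {X₀ N} * (sI N ^ 2 * 1) ^ (∅ : Finset (TPt 4 N)).card +
    pI N ∅ * (sI N ^ 2 * 1) ^ (({0} : Finset (TPt 4 N))).card with hm
  have hm0 : 0 ≤ m := by have := pI_pos N {X₀ N}; have := pI_pos N ∅; have := sI_pos N; positivity
  have hm2 : m ≤ 2 := by
    have h1 := maj_le_one N ⟨∅, ({X₀ N}, ∅)⟩
    have h2 := maj_le_one N ⟨{0}, (∅, {0})⟩
    simp only at h1 h2
    linarith
  have hsum : cI N r ⟨∅, ({X₀ N}, ∅)⟩ + cI N r ⟨{0}, (∅, {0})⟩ = m * (cM r / 2) := by unfold cI; simp only; ring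
  have hπ : 0 < Real.sqrt Real.pi := Real.sqrt_pos.2 Real.pi_pos
  have hlt : Real.sqrt Real.pi < Real.sqrt (2 * Real.pi) := Real.sqrt_lt_sqrt Real.pi_pos.le (by linarith [Real.pi_pos])
  have hq : Real.sqrt Real.pi / Real.sqrt (2 * Real.pi) < 1 := (div_lt_one (hπ.trans hlt)).2 hlt
  have hq0 : 0 ≤ Real.sqrt Real.pi / Real.sqrt (2 * Real.pi) := by positivity
  have hA : Acst ≤ 1 := dressedConst_le_one
  have hb := norm_term_le r hr hs
  have hn : ‖((cI N r ⟨∅, ({X₀ N}, ∅)⟩ + cI N r ⟨{0}, (∅, {0})⟩ : ℝ) : ℂ) *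
        ∫ v : E1, cexp (s * ((r : ℂ) * (Real.exp (-(crd v ^ 2)) : ℂ))) * cexp (-(((‖v‖ ^ 2 : ℝ) : ℂ)))‖ =
      m * ‖((cM r / 2 : ℝ) : ℂ) * ∫ v : E1, cexp (s * ((r : ℂ) * (Real.exp (-(crd v ^ 2)) : ℂ))) *
        cexp (-(((‖v‖ ^ 2 : ℝ) : ℂ)))‖ := by
    rw [hsum, norm_mul, norm_mul, Complex.norm_real, Complex.norm_real, Real.norm_eq_abs, Real.norm_eq_abs, abs_mul,
      abs_of_nonneg hm0]
    ring
  rw [hn]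
  calc m * ‖((cM r / 2 : ℝ) : ℂ) * ∫ v : E1, cexp (s * ((r : ℂ) * (Real.exp (-(crd v ^ 2)) : ℂ))) *
          cexp (-(((‖v‖ ^ 2 : ℝ) : ℂ)))‖
      ≤ 2 * (Acst / 2 * (Real.sqrt Real.pi / Real.sqrt (2 * Real.pi))) := mul_le_mul hm2 hb (norm_nonneg _) zero_le_two
    _ = Acst * (Real.sqrt Real.pi / Real.sqrt (2 * Real.pi)) := by ring
    _ < 1 := by
        have := Acst_pos
        nlinarith

open Classical in
/-- **THE END's BOUNDED QUANTITY IS NOT ZERO** [decided toy]: equal dressed outputs on the cube would give equal activities at `X₀` (W24's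
`exp_locE_cube` BY NAME), contradicting `actI_live`. [folklore] -/
theorem innerEnd_live (hr0 : 0 < r) (k : ℕ) :
    locE (tgeometry 4 N).ι (tgeometry 4 N).cubes (actI N r hr k 1) ((tgeometry 4 N).cubes (X₀ N)) ≠
      locE (tgeometry 4 N).ι (tgeometry 4 N).cubes (actI N r hr k 0) ((tgeometry 4 N).cubes (X₀ N)) := by
  intro h
  have h1 := exp_locE_cube N (w := actI N r hr k 1) (norm_actI_X₀_lt_one N r hr k (by simp))
  have h0 := exp_locE_cube N (w := actI N r hr k 0) (norm_actI_X₀_lt_one N r hr k (by simp))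
  have h' : cexp (locE (TTouch (d := 4) (N := N)) (fun Z : (tsys 4 N).Dom => Z.1) (actI N r hr k 1) {0}) =
      cexp (locE (TTouch (d := 4) (N := N)) (fun Z : (tsys 4 N).Dom => Z.1) (actI N r hr k 0) {0}) := congrArg cexp h
  rw [h1, h0, add_right_inj] at h'
  exact actI_live N r hr hr0 k h'

end Torus

end Summit.QuantumFields.BalabanUV.T4Continuum.NE1p.DressedSmallFieldInnerLabelsWitness

end
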